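import Literature.Analysis.FluidPDE.PassiveScalarEnergySobolev
import Literature.Analysis.FluidPDE.SeisDissipationRateBoundProofs
import HarnessLib

/-!
# Energy inequality for the passive scalar with `L¹ₜ Ḣ¹ₓ` drift (renormalisation)

Analysis/FluidPDE proof-support file (everything proved). The tree's energy inequality for weak
solutions with Sobolev drift, `PassiveScalarEnergySobolev.energy_ineq_of_eGradNormSq_le`, assumes
the drift gradient bounded in time (`eGradNormSq (u t) ≤ G` a.e.). Here the same DiPerna–Lions
renormalisation argument is run under the **time-integrated** hypothesis
`∫₀ᵀ ‖∇u(t)‖_{L²} dt < ∞` (the strain budget of Seis 2022, Rmk. 1, and of the logarithmic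
dissipation bound for releases): `2 · eScalarDissipation κ θ 0 T ≤ ∫ ‖θ₀‖ₑ²`
(`energy_ineq_of_lintegral_eGradNormSq_rpow_lt_top`). The only change is in the domination of
the DiPerna–Lions commutator, whose `L¹ₓ` size at time `t` is `≤ ‖θ(t)‖₂ ‖∇u(t)‖₂ c_d` — an
integrable function of `t` rather than a constant.

## References

* R. J. DiPerna, P.-L. Lions, Invent. Math. 98 (1989), §II.3, Thm. II.3. [`DiPernaLions1989`]
* C. Seis, Comm. Math. Phys. 399 (2023) = arXiv:2003.08794, Rmk. 1 and proof of Thm. 2 (p. 8).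
  [`Seis2022`]
-/

noncomputable section

open MeasureTheory TopologicalSpace Set Function Filter Topology Metric ContinuousLinearMap
  UnitAddTorus
open scoped ENNReal NNReal Convolution ContDiff InnerProductSpace

namespace Literature.Analysis.FluidPDE

namespace Torus

variable {d : Type*} [Fintype d]

namespace IsWeakScalarTransportOn

variable {T κ : ℝ} {u : ℝ → UnitAddTorus d → EuclideanSpace ℝ d} {θ₀ : UnitAddTorus d → ℝ}
  {θ : ℝ → UnitAddTorus d → ℝ}

/-- **Energy inequality for weak solutions of the passive scalar equation with `L¹ₜ Ḣ¹ₓ` drift**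
(DiPerna–Lions 1989, §II.3 renormalisation with the `L²`/`L²` integrability pairing; the
time-integrated form of the hypothesis of Seis 2022, Rmk. 1): for `κ > 0`, `θ₀ ∈ L²`, a weak
solution `θ ∈ L^∞(0,T;L²)` whose drift has `∫₀ᵀ ‖∇u(t)‖_{L²} dt < ∞`,
`2 · eScalarDissipation κ θ 0 T ≤ ∫ ‖θ₀‖ₑ²`. Same proof as
`energy_ineq_of_eGradNormSq_le`, the commutator being dominated in time by the integrable
`t ↦ ‖θ(t)‖₂ ‖∇u(t)‖₂` instead of a constant. [cite: DiPernaLions1989, §II.3 Thm. II.3] -/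
theorem energy_ineq_of_lintegral_eGradNormSq_rpow_lt_top (hκ : 0 < κ) (h : IsWeakScalarTransportOn T κ u θ₀ θ)
    (hθ₀ : MemLp θ₀ 2 volume)
    (hG : ∫⁻ t in Ioo 0 T, FunctionSpaces.Torus.eGradNormSq (u t) ^ (1 / 2 : ℝ) < ⊤) :
    2 * eScalarDissipation κ θ 0 T ≤ ∫⁻ x, ‖θ₀ x‖ₑ ^ 2 := by
  classical
  -- trivial case `T ≤ 0`
  rcases le_or_gt T 0 with hT | hT
  · have h0 : eScalarDissipation κ θ 0 T = 0 := by
      rw [eScalarDissipation, Ioo_eq_empty_of_le hT, Measure.restrict_empty, lintegral_zero_measure,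
        mul_zero]
    rw [h0, mul_zero]
    exact zero_le
  set μT : Measure ℝ := (volume : Measure ℝ).restrict (Ioo 0 T) with hμT
  haveI : IsFiniteMeasure μT := by rw [hμT]; infer_instance
  -- radii and kernels
  obtain ⟨hε, hε', hε0⟩ := molRadius_spec
  set ε : ℕ → ℝ := fun n => 1 / (4 * ((n : ℝ) + 1)) with hε_def
  set kk : ℕ → UnitAddTorus d → ℝ := fun n => FunctionSpaces.Torus.kernel (d := d) (ε n) with hkk
  have hkS : ∀ n, FunctionSpaces.Torus.IsSmooth (kk n) := fun n => FunctionSpaces.Torus.isSmooth_kernel (hε n) (hε' n)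
  have hk1 : ∀ n, ∫⁻ y, ‖kk n y‖ₑ = 1 := fun n => FunctionSpaces.Torus.lintegral_enorm_kernel (hε n) (hε' n)
  -- bounds on the slices
  obtain ⟨C₁, hC₁⟩ := h.exists_eLpNorm_le
  have hθ₀i : Integrable θ₀ volume := hθ₀.integrable one_le_two
  have hgood : ∀ᵐ s ∂μT, (Integrable (θ s) volume ∧ AEStronglyMeasurable (u s) volume ∧
      Integrable (fun y => ‖u s y‖ * θ s y) volume) ∧ FunctionSpaces.Torus.IsWeaklyDivFree (u s) ∧
      MemLp (θ s) 2 volume ∧ eLpNorm (θ s) 2 volume ≤ C₁ ∧ Integrable (u s) volume ∧ MemLp (u s) 2 volume ∧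
      FunctionSpaces.Torus.eGradNormSq (u s) < ⊤ := by
    have hGm : AEMeasurable (fun t => FunctionSpaces.Torus.eGradNormSq (u t)) μT :=
      aemeasurable_eGradNormSq_slice h.aestronglyMeasurable_uncurry_velocity
    have hGfin : ∀ᵐ s ∂μT, FunctionSpaces.Torus.eGradNormSq (u s) < ⊤ := by
      have h1 : ∀ᵐ s ∂μT, FunctionSpaces.Torus.eGradNormSq (u s) ^ (1 / 2 : ℝ) < ⊤ :=
        ae_lt_top' (hGm.pow_const _) hG.ne
      filter_upwards [h1] with s hs
      by_contra htop
      rw [not_lt, top_le_iff] at htop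
      rw [htop, ENNReal.top_rpow_of_pos (by norm_num)] at hs
      exact lt_irrefl _ hs
    filter_upwards [h.ae_slice_integrable₁, h.ae_isWeaklyDivFree, h.ae_memLp_two, hC₁, h.ae_integrable_velocity,
      h.ae_memLp_two_velocity, hGfin] with s h1 h2 h3 h4 h5 h6 h7
    exact ⟨h1, h2, h3, h4, h5, h6, h7⟩
  -- conversions between the integral and the convolution forms
  have hconv : ∀ (δ : UnitAddTorus d → ℝ) (n : ℕ) (x : UnitAddTorus d), (δ ⋆ kk n) x = ∫ y, δ y * kk n (x - y) :=
    fun δ n x => by simp only [convolution_lsmul, smul_eq_mul]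
  -- ### the commutator size `ρ n s = ∫ |r_n(s,x)| dx`
  set ρ : ℕ → ℝ → ℝ≥0∞ := fun n s => ∫⁻ x, ‖∫ y, θ s y * ⟪u s x - u s y,
    FunctionSpaces.Torus.gradient (kk n) (x - y)⟫_ℝ‖ₑ with hρ_def
  have hρm : ∀ n, AEMeasurable (ρ n) μT := fun n => h.aemeasurable_lintegral_enorm_comm (hkS n)
  have hGm : AEMeasurable (fun t => FunctionSpaces.Torus.eGradNormSq (u t)) μT :=
    aemeasurable_eGradNormSq_slice h.aestronglyMeasurable_uncurry_velocity
  set Kρ : ℝ → ℝ≥0∞ := fun s => (C₁ : ℝ≥0∞) * FunctionSpaces.Torus.eGradNormSq (u s) ^ (1 / 2 : ℝ) *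
    ENNReal.ofReal (FunctionSpaces.Torus.gradProfileMass d) with hKρ
  have hKρm : AEMeasurable Kρ μT := ((hGm.pow_const _).const_mul _).mul_const _
  have hKρt : ∫⁻ s, Kρ s ∂μT ≠ ⊤ := by
    rw [hKρ, lintegral_mul_const'' _ ((hGm.pow_const _).const_mul _), lintegral_const_mul'' _ (hGm.pow_const _)]
    exact ENNReal.mul_ne_top (ENNReal.mul_ne_top ENNReal.coe_ne_top hG.ne) ENNReal.ofReal_ne_top
  have hρle : ∀ n, ∀ᵐ s ∂μT, ρ n s ≤ Kρ s := by
    intro n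
    filter_upwards [hgood] with s hs
    obtain ⟨-, -, hθ2, hθC, -, hu2, -⟩ := hs
    refine (lintegral_enorm_comm_le_eGradNormSq hθ2 hu2 (hε n) (hε' n)).trans ?_
    simp only [hKρ]
    gcongr
  have hρ0 : ∀ᵐ s ∂μT, Tendsto (fun n => ρ n s) atTop (𝓝 0) := by
    filter_upwards [hgood] with s hs
    obtain ⟨⟨-, -, huθ⟩, hdiv, hθ2, -, hui, hu2, huG⟩ := hs
    exact tendsto_lintegral_enorm_comm hθ2 hui huθ hdiv (B := FunctionSpaces.Torus.eGradNormSq (u s) ^ (1 / 2 : ℝ))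
      (ENNReal.rpow_ne_top_of_nonneg (by norm_num) huG.ne) hε hε' hε0 fun n z hz =>
      eLpNorm_sub_translate_le_of_gradient_kernel_ne_zero hu2 (hε n) (hε' n) hz
  have hP0 : Tendsto (fun n => ∫⁻ s, ρ n s ∂μT) atTop (𝓝 0) := by
    have := tendsto_lintegral_of_dominated_convergence' Kρ hρm hρle hKρt
      (hρ0.mono fun s hs => by simpa using hs)
    simpa using this
  have hPt : ∀ n, ∫⁻ s, ρ n s ∂μT ≠ ⊤ := fun n =>
    ne_top_of_le_ne_top hKρt (lintegral_mono_ae (hρle n))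
  -- ### the datum term
  set a : ℝ≥0∞ := ∫⁻ x, ‖θ₀ x‖ₑ ^ 2 with ha_def
  have hat : a ≠ ⊤ := by
    rw [ha_def, ← PassiveScalarProofs.eLpNorm_two_pow_two]
    exact ENNReal.pow_ne_top hθ₀.eLpNorm_ne_top
  have ha0 : ∀ n, ENNReal.ofReal (∫ x, (θ₀ ⋆ kk n) x ^ 2) ≤ a := by
    intro n
    have hc : Continuous (θ₀ ⋆ kk n) := FunctionSpaces.Torus.continuous_convolution hθ₀i (hkS n).continuous
    rw [← lintegral_enorm_sq_eq_ofReal_integral_sq hc, ← PassiveScalarProofs.eLpNorm_two_pow_two, ha_def,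
      ← PassiveScalarProofs.eLpNorm_two_pow_two]
    gcongr
    calc eLpNorm (θ₀ ⋆ kk n) 2 volume ≤ (∫⁻ y, ‖kk n y‖ₑ) * eLpNorm θ₀ 2 volume :=
          FunctionSpaces.Torus.eLpNorm_convolution_le hθ₀.1 (hkS n).continuous.aestronglyMeasurable one_le_two
      _ = eLpNorm θ₀ 2 volume := by rw [hk1 n, one_mul]
  -- ### the renormalised dissipation `D M n s = ∫ β_M''(A_n(s)) ‖∇A_n(s)‖²` (measurable form)
  set D : ℕ → ℕ → ℝ → ℝ := fun M n s => ∫ x, deriv (Calculus.renormDeriv (M : ℝ)) (∫ y, θ s y * kk n (x - y)) *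
    ‖(θ s ⋆ FunctionSpaces.Torus.gradient (kk n)) x‖ ^ 2 with hD_def
  have hβ''c : ∀ M : ℕ, Continuous (deriv (Calculus.renormDeriv (M : ℝ))) := fun M =>
    (Calculus.contDiff_renormDeriv (M : ℝ)).continuous_deriv (by simp)
  have hβ''b : ∀ (M : ℕ) (y : ℝ), 0 ≤ deriv (Calculus.renormDeriv (M : ℝ)) y ∧ deriv (Calculus.renormDeriv (M : ℝ)) y ≤ 2 := by
    intro M y
    rw [Calculus.deriv_renormDeriv]
    refine ⟨by positivity, ?_⟩
    have h1 := Calculus.abs_truncCutoff_le_one (M : ℝ) y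
    rw [abs_le] at h1
    nlinarith [(Calculus.truncCutoff (M : ℝ)).nonneg (x := y)]
  have hDm : ∀ (M n : ℕ), AEStronglyMeasurable (D M n) μT := fun M n =>
    h.aestronglyMeasurable_integral_comp_mul_norm_sq (hkS n) (hβ''c M)
  have hD0 : ∀ (M n : ℕ) (s : ℝ), 0 ≤ D M n s := fun M n s =>
    integral_nonneg fun x => mul_nonneg (hβ''b M _).1 (sq_nonneg _)
  have hDb : ∀ (M n : ℕ), ∃ K : ℝ, ∀ᵐ s ∂μT, D M n s ≤ K := by
    intro M n
    obtain ⟨Ck, hCk⟩ := FunctionSpaces.Torus.exists_forall_norm_le_of_continuous (hkS n).gradient.continuous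
    refine ⟨2 * (Ck * C₁) ^ 2, ?_⟩
    filter_upwards [hgood] with s hs
    obtain ⟨⟨hθi, -, -⟩, -, hθ2, hθC, -⟩ := hs
    have hpt : ∀ x, ‖(θ s ⋆ FunctionSpaces.Torus.gradient (kk n)) x‖ ≤ Ck * C₁ := fun x => by
      refine (FunctionSpaces.Torus.norm_convolution_le hθi hCk x).trans (mul_le_mul_of_nonneg_left ?_
        ((norm_nonneg _).trans (hCk 0)))
      have e : ∫ y, ‖θ s y‖ = ∫ y, |θ s y| := integral_congr_ae (Eventually.of_forall fun y => by
        simp [Real.norm_eq_abs])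
      rw [e]
      exact integral_abs_le_of_eLpNorm_le hθ2 hθC
    have hc : Continuous fun x => deriv (Calculus.renormDeriv (M : ℝ)) (∫ y, θ s y * kk n (x - y)) *
        ‖(θ s ⋆ FunctionSpaces.Torus.gradient (kk n)) x‖ ^ 2 := by
      refine ((hβ''c M).comp ?_).mul ((FunctionSpaces.Torus.continuous_convolution hθi (hkS n).gradient.continuous).norm.pow 2)
      have e : (fun x => ∫ y, θ s y * kk n (x - y)) = θ s ⋆ kk n := funext fun x => (hconv (θ s) n x).symm
      rw [e]
      exact FunctionSpaces.Torus.continuous_convolution hθi (hkS n).continuous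
    calc D M n s ≤ ∫ _ : UnitAddTorus d, 2 * (Ck * C₁) ^ 2 := by
          refine integral_mono hc.integrable_unitAddTorus (integrable_const _) fun x => ?_
          dsimp only
          exact mul_le_mul (hβ''b M _).2 (pow_le_pow_left₀ (norm_nonneg _) (hpt x) 2) (sq_nonneg _) zero_le_two
      _ = 2 * (Ck * C₁) ^ 2 := by simp
  have hDi : ∀ (M n : ℕ), Integrable (D M n) μT := by
    intro M n
    obtain ⟨K, hK⟩ := hDb M n
    refine Integrable.mono' (integrable_const (max K 0)) (hDm M n) ?_
    filter_upwards [hK] with s hs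
    rw [Real.norm_eq_abs, abs_of_nonneg (hD0 M n s)]
    exact hs.trans (le_max_left _ _)
  -- `D` versus the spectral dissipation of the truncated mollified slice, a.e.
  have hDe : ∀ (M n : ℕ), ∀ᵐ s ∂μT, ENNReal.ofReal (2 * κ) * eScalarGradNormSq (Calculus.trunc (M : ℝ) ∘ (θ s ⋆ kk n)) =
      ENNReal.ofReal (κ * D M n s) := by
    intro M n
    filter_upwards [hgood] with s hs
    obtain ⟨⟨hθi, -, -⟩, -⟩ := hs
    have hA : FunctionSpaces.Torus.IsSmooth (θ s ⋆ kk n) := FunctionSpaces.Torus.isSmooth_convolution hθi (hkS n)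
    rw [← ofReal_mul_integral_renorm_dissipation hA (M : ℝ) hκ.le, hD_def]
    congr 2
    refine integral_congr_ae (Eventually.of_forall fun x => ?_)
    dsimp only
    rw [← hconv (θ s) n x, FunctionSpaces.Torus.gradient_convolution hθi (hkS n) x]
  have hem : ∀ (M n : ℕ), AEMeasurable (fun s => ENNReal.ofReal (2 * κ) *
      eScalarGradNormSq (Calculus.trunc (M : ℝ) ∘ (θ s ⋆ kk n))) μT := fun M n =>
    (((hDm M n).aemeasurable.const_mul κ).ennreal_ofReal).congr ((hDe M n).mono fun s hs => hs.symm)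
  -- ### **the core estimate**: for a.e. `t`, `ofReal (κ ∫_{(0,t]} D) ≤ a + C_M ∫⁻ ρ_n`
  set Cβ : ℕ → ℝ := fun M => 4 * ((Calculus.truncCutoff (M : ℝ)).rIn + 1) with hCβ
  have hCβ0 : ∀ M, 0 ≤ Cβ M := fun M => by
    have := (Calculus.truncCutoff (M : ℝ)).rIn_pos; rw [hCβ]; positivity
  have hcore : ∀ (M n : ℕ), ∀ᵐ t ∂μT, ENNReal.ofReal (κ * ∫ s in Ioc 0 t, D M n s) ≤
      a + ENNReal.ofReal (Cβ M) * ∫⁻ s, ρ n s ∂μT := by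
    intro M n
    have hβ : ContDiff ℝ 1 (Calculus.renorm (M : ℝ)) := (Calculus.contDiff_renorm (M : ℝ)).of_le (by simp)
    have hβtop : ContDiff ℝ ∞ (Calculus.renorm (M : ℝ)) := Calculus.contDiff_renorm (M : ℝ)
    have hβK := Calculus.lipschitzWith_renorm (M : ℝ)
    have hβ'b : ∀ y, |deriv (Calculus.renorm (M : ℝ)) y| ≤ Cβ M := fun y => by
      rw [Calculus.deriv_renorm]; exact Calculus.abs_renormDeriv_le_const (M : ℝ) y
    have hβ'c : Continuous (deriv (Calculus.renorm (M : ℝ))) := hβ.continuous_deriv le_rfl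
    -- the three time-integrands on `(0,T)`
    set Φ : ℝ → ℝ := fun s => ∫ x, deriv (Calculus.renorm (M : ℝ)) (∫ y, θ s y * kk n (x - y)) *
      ∫ y, θ s y * (-⟪u s y, FunctionSpaces.Torus.gradient (kk n) (x - y)⟫_ℝ + κ * FunctionSpaces.Torus.laplacian (kk n) (x - y))
      with hΦ_def
    set R : ℝ → ℝ := fun s => ∫ x, deriv (Calculus.renorm (M : ℝ)) ((θ s ⋆ kk n) x) *
      ∫ y, θ s y * ⟪u s x - u s y, FunctionSpaces.Torus.gradient (kk n) (x - y)⟫_ℝ with hR_def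
    have hΦi : Integrable Φ μT := (h.integrable_comp_molInt_mul_flux (hkS n) hβ'c hβ'b).integral_prod_left
    -- the slice identity `Φ = R - κ D` a.e.
    have hslice : ∀ᵐ s ∂μT, Φ s = R s - κ * D M n s := by
      filter_upwards [hgood] with s hs
      obtain ⟨⟨hθi, hum, huθ⟩, hdiv, -, -, hui, -⟩ := hs
      have hid := integral_deriv_comp_mul_flux_eq hβtop hθi hui huθ hdiv (hkS n) κ
      have e1 : Φ s = ∫ x, deriv (Calculus.renorm (M : ℝ)) ((θ s ⋆ kk n) x) *
          ∫ y, θ s y * (-⟪u s y, FunctionSpaces.Torus.gradient (kk n) (x - y)⟫_ℝ + κ * FunctionSpaces.Torus.laplacian (kk n) (x - y)) := by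
        simp only [hΦ_def, hconv]
      have e2 : D M n s = ∫ x, deriv (deriv (Calculus.renorm (M : ℝ))) ((θ s ⋆ kk n) x) *
          ‖FunctionSpaces.Torus.gradient (θ s ⋆ kk n) x‖ ^ 2 := by
        simp only [hD_def]
        refine integral_congr_ae (Eventually.of_forall fun x => ?_)
        dsimp only
        rw [Calculus.deriv_renorm, ← hconv (θ s) n x, FunctionSpaces.Torus.gradient_convolution hθi (hkS n) x]
      rw [e1, hid, e2]
    -- the bound `|R| ≤ C_M ρ` a.e.
    have hRle : ∀ᵐ s ∂μT, |R s| ≤ Cβ M * (ρ n s).toReal := by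
      filter_upwards [hρle n, hgood] with s hs hg
      obtain ⟨⟨hθi, hum, -⟩, -, -, -, -, -, huG⟩ := hg
      have hKρs : Kρ s < ⊤ := by
        simp only [hKρ]
        exact ENNReal.mul_lt_top (ENNReal.mul_lt_top ENNReal.coe_lt_top
          (ENNReal.rpow_lt_top_of_nonneg (by norm_num) huG.ne)) ENNReal.ofReal_lt_top
      have hKc : Continuous fun p : UnitAddTorus d × UnitAddTorus d =>
          FunctionSpaces.Torus.gradient (kk n) (p.1 - p.2) :=
        (hkS n).gradient.continuous.comp (continuous_fst.sub continuous_snd)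
      have hP : AEStronglyMeasurable (Function.uncurry fun (x y : UnitAddTorus d) => θ s y * ⟪u s x - u s y,
          FunctionSpaces.Torus.gradient (kk n) (x - y)⟫_ℝ) ((volume : Measure (UnitAddTorus d)).prod volume) :=
        (hθi.aestronglyMeasurable.comp_snd).mul (((hum.comp_fst).sub (hum.comp_snd)).inner hKc.aestronglyMeasurable)
      have hrm : AEStronglyMeasurable (fun x => ∫ y, θ s y * ⟪u s x - u s y,
          FunctionSpaces.Torus.gradient (kk n) (x - y)⟫_ℝ) volume := hP.integral_prod_right'
      exact abs_integral_mul_le_mul_toReal_lintegral (fun x => hβ'b _) hrm (hs.trans_lt hKρs)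
    -- `R` is integrable on `(0,T)`
    have hRm : AEStronglyMeasurable R μT := by
      have e : R =ᵐ[μT] fun s => Φ s + κ * D M n s := by
        filter_upwards [hslice] with s hs
        rw [hs]; ring
      exact (hΦi.aestronglyMeasurable.add ((hDm M n).const_mul κ)).congr e.symm
    have hRi : Integrable R μT := by
      refine Integrable.mono' ((integrable_toReal_of_lintegral_ne_top (hρm n) (hPt n)).const_mul (Cβ M)) hRm ?_
      filter_upwards [hRle] with s hs
      rw [Real.norm_eq_abs]
      exact hs
    -- now the good times
    filter_upwards [h.ae_integral_comp_molInt_eq hθ₀i (hkS n) hβ hβK, ae_restrict_mem measurableSet_Ioo]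
      with t hid htT
    have hsub : Ioc 0 t ⊆ Ioo 0 T := Ioc_subset_Ioo_right htT.2
    have hle : (volume : Measure ℝ).restrict (Ioc 0 t) ≤ μT := Measure.restrict_mono_set _ hsub
    have hΦi' : IntegrableOn Φ (Ioc 0 t) volume := hΦi.mono_measure hle
    have hDi' : IntegrableOn (D M n) (Ioc 0 t) volume := (hDi M n).mono_measure hle
    have hRi' : IntegrableOn R (Ioc 0 t) volume := hRi.mono_measure hle
    -- `∫_{(0,t]} Φ = ∫_{(0,t]} R - κ ∫_{(0,t]} D`
    have hsplit : ∫ s in Ioc 0 t, Φ s = (∫ s in Ioc 0 t, R s) - κ * ∫ s in Ioc 0 t, D M n s := by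
      rw [← MeasureTheory.integral_const_mul, ← integral_sub hRi' (hDi'.const_mul κ)]
      exact integral_congr_ae (ae_restrict_of_ae_restrict_of_subset hsub hslice)
    -- the renormalised identity in real form: `κ ∫ D = ∫ β(A₀) - ∫ β(A(t)) + ∫ R`
    have hidΦ : ∫ x, Calculus.renorm (M : ℝ) (∫ y, θ t y * kk n (x - y)) =
        (∫ x, Calculus.renorm (M : ℝ) (∫ y, θ₀ y * kk n (x - y))) + ∫ s in Ioc 0 t, Φ s := hid
    have hpos : 0 ≤ ∫ x, Calculus.renorm (M : ℝ) (∫ y, θ t y * kk n (x - y)) :=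
      integral_nonneg fun x => Calculus.renorm_nonneg _ _
    have hdat : ∫ x, Calculus.renorm (M : ℝ) (∫ y, θ₀ y * kk n (x - y)) ≤ ∫ x, (θ₀ ⋆ kk n) x ^ 2 := by
      have hc : Continuous (θ₀ ⋆ kk n) := FunctionSpaces.Torus.continuous_convolution hθ₀i (hkS n).continuous
      have e : (fun x => Calculus.renorm (M : ℝ) (∫ y, θ₀ y * kk n (x - y))) = fun x => Calculus.renorm (M : ℝ) ((θ₀ ⋆ kk n) x) :=
        funext fun x => by rw [hconv]
      rw [e]
      exact integral_mono ((Calculus.contDiff_renorm (M : ℝ)).continuous.comp hc).integrable_unitAddTorus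
        (hc.pow 2).integrable_unitAddTorus fun x => Calculus.renorm_le_sq _ _
    have hRabs : ∫ s in Ioc 0 t, R s ≤ Cβ M * ∫ s in Ioc 0 t, (ρ n s).toReal := by
      rw [← MeasureTheory.integral_const_mul]
      refine integral_mono_ae hRi' ((integrable_toReal_of_lintegral_ne_top (hρm n) (hPt n)).const_mul (Cβ M)
        |>.mono_measure hle) ?_
      exact ae_restrict_of_ae_restrict_of_subset hsub (hRle.mono fun s hs => (le_abs_self _).trans hs)
    have hreal : κ * ∫ s in Ioc 0 t, D M n s ≤ (∫ x, (θ₀ ⋆ kk n) x ^ 2) + Cβ M * ∫ s in Ioc 0 t, (ρ n s).toReal := by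
      have := hsplit
      linarith
    -- pass to `ℝ≥0∞`
    have hρint : ENNReal.ofReal (∫ s in Ioc 0 t, (ρ n s).toReal) ≤ ∫⁻ s, ρ n s ∂μT :=
      calc ENNReal.ofReal (∫ s in Ioc 0 t, (ρ n s).toReal)
          ≤ ∫⁻ s in Ioc 0 t, ENNReal.ofReal ((ρ n s).toReal) := ofReal_integral_le_lintegral_ofReal _
        _ ≤ ∫⁻ s in Ioc 0 t, ρ n s := lintegral_mono fun s => ENNReal.ofReal_toReal_le
        _ ≤ ∫⁻ s, ρ n s ∂μT := lintegral_mono' hle le_rfl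
    calc ENNReal.ofReal (κ * ∫ s in Ioc 0 t, D M n s)
        ≤ ENNReal.ofReal ((∫ x, (θ₀ ⋆ kk n) x ^ 2) + Cβ M * ∫ s in Ioc 0 t, (ρ n s).toReal) :=
          ENNReal.ofReal_le_ofReal hreal
      _ ≤ ENNReal.ofReal (∫ x, (θ₀ ⋆ kk n) x ^ 2) + ENNReal.ofReal (Cβ M * ∫ s in Ioc 0 t, (ρ n s).toReal) :=
          ENNReal.ofReal_add_le
      _ ≤ a + ENNReal.ofReal (Cβ M) * ∫⁻ s, ρ n s ∂μT := by
          refine add_le_add (ha0 n) ?_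
          rw [ENNReal.ofReal_mul (hCβ0 M)]
          gcongr
  -- ### from a.e. `t` to `t = T`: `∫⁻ 2κ e_{M,n} ≤ a + C_M ∫⁻ ρ_n`
  have hT_bound : ∀ (M n : ℕ), ∫⁻ s, ENNReal.ofReal (2 * κ) * eScalarGradNormSq (Calculus.trunc (M : ℝ) ∘ (θ s ⋆ kk n)) ∂μT ≤
      a + ENNReal.ofReal (Cβ M) * ∫⁻ s, ρ n s ∂μT := by
    intro M n
    set Rhs : ℝ≥0∞ := a + ENNReal.ofReal (Cβ M) * ∫⁻ s, ρ n s ∂μT with hRhs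
    have hRt : Rhs ≠ ⊤ := ENNReal.add_ne_top.2 ⟨hat, ENNReal.mul_ne_top ENNReal.ofReal_ne_top (hPt n)⟩
    have hK : ∀ᵐ t ∂μT, ∫ s in Ioc 0 t, D M n s ≤ Rhs.toReal / κ := by
      filter_upwards [hcore M n] with t ht
      rw [le_div_iff₀ hκ, mul_comm]
      exact (ENNReal.ofReal_le_iff_le_toReal hRt).1 ht
    have hTT := setIntegral_Ioo_le_of_ae_setIntegral_Ioc_le hT (hDi M n) hK
    rw [le_div_iff₀ hκ, mul_comm] at hTT
    calc ∫⁻ s, ENNReal.ofReal (2 * κ) * eScalarGradNormSq (Calculus.trunc (M : ℝ) ∘ (θ s ⋆ kk n)) ∂μT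
        = ∫⁻ s, ENNReal.ofReal (κ * D M n s) ∂μT := lintegral_congr_ae (hDe M n)
      _ = ENNReal.ofReal (κ * ∫ s, D M n s ∂μT) := by
          rw [← MeasureTheory.integral_const_mul, ofReal_integral_eq_lintegral_ofReal ((hDi M n).const_mul κ)
            (Eventually.of_forall fun s => mul_nonneg hκ.le (hD0 M n s))]
      _ ≤ Rhs := (ENNReal.ofReal_le_ofReal hTT).trans_eq (ENNReal.ofReal_toReal hRt)
  -- ### lower semicontinuity, twice, and Fatou, twice
  have h2κ : (2 : ℝ≥0∞) * ENNReal.ofReal κ = ENNReal.ofReal (2 * κ) := by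
    rw [ENNReal.ofReal_mul zero_le_two, ENNReal.ofReal_ofNat]
  -- `n → ∞` at fixed `M`: `S_M ∘ A_n(s) → S_M ∘ θ(s)` in `L²`
  have hE0 : ∀ᵐ s ∂μT, Tendsto (fun n => eLpNorm (θ s ⋆ kk n - θ s) 2 volume) atTop (𝓝 0) := by
    filter_upwards [hgood] with s hs
    exact FunctionSpaces.Torus.tendsto_eLpNorm_convolution_sub_self hs.2.2.1
      (fun n y => FunctionSpaces.Torus.kernel_nonneg (hε n).le y)
      (fun n => FunctionSpaces.Torus.integral_kernel (hε n) (hε' n)) (fun n => FunctionSpaces.Torus.support_kernel_subset (hε n))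
      (fun n => FunctionSpaces.Torus.continuous_kernel (hε n) (hε' n)) hε0
  have hlsc_n : ∀ᵐ s ∂μT, ∀ M : ℕ, ENNReal.ofReal (2 * κ) * eScalarGradNormSq (Calculus.trunc (M : ℝ) ∘ θ s) ≤
      liminf (fun n => ENNReal.ofReal (2 * κ) * eScalarGradNormSq (Calculus.trunc (M : ℝ) ∘ (θ s ⋆ kk n))) atTop := by
    filter_upwards [hgood, hE0] with s hs hs0 M
    obtain ⟨⟨hθi, -, -⟩, -, hθ2, -⟩ := hs
    have hSc : Continuous (Calculus.trunc (M : ℝ)) := (Calculus.contDiff_trunc (M : ℝ)).continuous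
    have hSθi : Integrable (Calculus.trunc (M : ℝ) ∘ θ s) volume := by
      refine Integrable.mono' hθi.norm (hSc.comp_aestronglyMeasurable hθi.aestronglyMeasurable)
        (Eventually.of_forall fun x => ?_)
      rw [Function.comp_apply, Real.norm_eq_abs, Real.norm_eq_abs]
      exact Calculus.abs_trunc_le _ _
    have hSAi : ∀ n, Integrable (Calculus.trunc (M : ℝ) ∘ (θ s ⋆ kk n)) volume := fun n =>
      (hSc.comp (FunctionSpaces.Torus.continuous_convolution hθi (hkS n).continuous)).integrable_unitAddTorus
    refine mul_eScalarGradNormSq_le_liminf hSθi hSAi ?_ ENNReal.ofReal_ne_top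
    refine tendsto_of_tendsto_of_tendsto_of_le_of_le tendsto_const_nhds hs0 (fun n => bot_le) fun n => ?_
    exact eLpNorm_trunc_comp_sub_le (M : ℝ) (θ s ⋆ kk n) (θ s)
  -- `M → ∞`: `S_M ∘ θ(s) → θ(s)` in `L²`
  have hlsc_M : ∀ᵐ s ∂μT, ENNReal.ofReal (2 * κ) * eScalarGradNormSq (θ s) ≤
      liminf (fun M : ℕ => ENNReal.ofReal (2 * κ) * eScalarGradNormSq (Calculus.trunc (M : ℝ) ∘ θ s)) atTop := by
    filter_upwards [hgood] with s hs
    obtain ⟨⟨hθi, -, -⟩, -, hθ2, -⟩ := hs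
    have hSθi : ∀ M : ℕ, Integrable (Calculus.trunc (M : ℝ) ∘ θ s) volume := fun M => by
      refine Integrable.mono' hθi.norm ((Calculus.contDiff_trunc (M : ℝ)).continuous.comp_aestronglyMeasurable
        hθi.aestronglyMeasurable) (Eventually.of_forall fun x => ?_)
      rw [Function.comp_apply, Real.norm_eq_abs, Real.norm_eq_abs]
      exact Calculus.abs_trunc_le _ _
    refine mul_eScalarGradNormSq_le_liminf hθi hSθi ?_ ENNReal.ofReal_ne_top
    exact tendsto_eLpNorm_trunc_comp_sub hθ2
  -- the limit of the right-hand sides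
  have hRHS : ∀ M : ℕ, liminf (fun n => a + ENNReal.ofReal (Cβ M) * ∫⁻ s, ρ n s ∂μT) atTop = a := by
    intro M
    refine Tendsto.liminf_eq ?_
    have h1 := ENNReal.Tendsto.const_mul hP0 (Or.inr ENNReal.ofReal_ne_top : (0 : ℝ≥0∞) ≠ 0 ∨ ENNReal.ofReal (Cβ M) ≠ ⊤)
    rw [mul_zero] at h1
    simpa using h1.const_add a
  calc 2 * eScalarDissipation κ θ 0 T
      = ∫⁻ s, ENNReal.ofReal (2 * κ) * eScalarGradNormSq (θ s) ∂μT := by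
        rw [eScalarDissipation, ← mul_assoc, h2κ, hμT, lintegral_const_mul' _ _ ENNReal.ofReal_ne_top]
    _ ≤ ∫⁻ s, liminf (fun M : ℕ => liminf (fun n => ENNReal.ofReal (2 * κ) *
          eScalarGradNormSq (Calculus.trunc (M : ℝ) ∘ (θ s ⋆ kk n))) atTop) atTop ∂μT := by
        refine lintegral_mono_ae ?_
        filter_upwards [hlsc_M, hlsc_n] with s h1 h2
        exact h1.trans (liminf_le_liminf (Eventually.of_forall h2))
    _ ≤ liminf (fun M : ℕ => ∫⁻ s, liminf (fun n => ENNReal.ofReal (2 * κ) *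
          eScalarGradNormSq (Calculus.trunc (M : ℝ) ∘ (θ s ⋆ kk n))) atTop ∂μT) atTop :=
        lintegral_liminf_le' fun M => aemeasurable_liminf_nat fun n => hem M n
    _ ≤ liminf (fun M : ℕ => liminf (fun n => ∫⁻ s, ENNReal.ofReal (2 * κ) *
          eScalarGradNormSq (Calculus.trunc (M : ℝ) ∘ (θ s ⋆ kk n)) ∂μT) atTop) atTop :=
        liminf_le_liminf (Eventually.of_forall fun M => lintegral_liminf_le' fun n => hem M n)
    _ ≤ liminf (fun M : ℕ => liminf (fun n => a + ENNReal.ofReal (Cβ M) * ∫⁻ s, ρ n s ∂μT) atTop) atTop :=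
        liminf_le_liminf (Eventually.of_forall fun M => liminf_le_liminf (Eventually.of_forall fun n => hT_bound M n))
    _ = a := by simp_rw [hRHS]; exact liminf_const a

end IsWeakScalarTransportOn

end Torus

end Literature.Analysis.FluidPDE
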